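import Summits.ValiantsHypothesis.ValiantsHypothesis.Theorems.DivisionGapPerDivisionHardPerPowersCount

/-!
# Crux `DivisionGap.PerDivisionHard` (stmt-ValiantsHypothesis-5065), line `pair-descent-jss-endpoint` —
stub `stub_pureCount`: the typed vertex count for ARBITRARY margins

`stub_pureCount`: let `g ∈ ℝ≥0[x_ij]` (`n ≥ 3`) have row margins `R` and column margins `Cc`
(every monomial `α` of `g` has `∑_j α(i,j) = R i`, `∑_i α(i,j) = Cc j`), with `R i ≥ 1` for every
row.  Then the permutations `π` whose PURE monomial of type `R`, `Σ_j R(π j) · e_{(π j, j)}` (the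
unique exponent vector with row sums `R` supported on the matching `{(π j, j)}`), occurs in `g`
number at most `L(g) · n!/2^{⌊n/3⌋}`.

This is the landed uniform-margin count `card_pure_mul_two_pow_le` / `pure_cover_count` of
`…PerPowersCount.lean` with `M ↦ (R, Cc)`, proved the same way [JerrumSnir1982, §3–§4.3]:

* *Walk* (`exists_rows_window_of_eval_ne_zero_rows`): a nonzero output with row margins `R ≥ 1`
  meets all `n` rows, so some gate value meets `k` rows with `n/3 < k ≤ 2(n/3)`
  (`exists_gate_rows_window`, margin-free).
* *Peel and type* (`exists_eval_eq_zeroAt_add`, `exists_sums_of_support_mul_subset_margins`):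
  `P.eval = (P.zeroAt v).eval + p · q`; over `ℝ≥0` `supp p + supp q ⊆ supp P.eval`, so all
  monomials of `p` share row sums `ρ` and column sums `γ`.
* *Type rigidity* (`card_pureServed_le_rows`): a pure monomial of type `R` on `π` inside
  `supp p + supp q` has its `p`-part on the cells `(π j, j)` (the pure vector vanishes off them),
  hence `ρ ∘ π = γ`: at most one coset of the stabiliser of `{ρ ≠ 0}`, `≤ k!(n-k)! ≤ n!/2^{⌊n/3⌋}`.
* *Count* (`pure_cover_count_rows`): induction on the number of nonzero gate values; finally a
  size-`L(g)` circuit (`exists_computes_size_eq_complexity`) has at most `L(g)` of them.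
-/

noncomputable section

-- `Summit.ValiantsHypothesis.ValiantsHypothesis.…` is the tree's mandated single-conjunct layout
-- (Sub = Summit), so the duplicated namespace component is intended.
set_option linter.dupNamespace false

namespace Summit.ValiantsHypothesis.ValiantsHypothesis.Theorems.DivisionGapPerDivisionHard

open MvPolynomial Literature.Computability.AlgebraicComplexity
open Literature.Computability.AlgebraicComplexity.ArithCircuit
open Literature.Barriers.ValiantsHypothesis
open Summit.ValiantsHypothesis.ValiantsHypothesis.Theorems.PerDivisionHard.Negative
open scoped NNReal Pointwise

variable {n : ℕ}

/-! ### Typing over `ℝ≥0` with arbitrary margins -/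

/-- Gate typing, arbitrary margins: if `supp (p * q) ⊆ supp g` with `q ≠ 0` and every monomial
of `g` has row sums `R` and column sums `Cc`, then all monomials of `p` have common row sums `ρ`
and column sums `γ` (those of `g` minus those of one fixed monomial of `q`; no cancellation over
`ℝ≥0`). [cite: JerrumSnir1982, §3.1 (Lemma 3.1(iii))] -/
theorem exists_sums_of_support_mul_subset_margins {g p q : MvPolynomial (Fin n × Fin n) ℝ≥0}
    {R Cc : Fin n → ℕ}
    (hg : ∀ α ∈ g.support, (∀ i, ∑ j, α (i, j) = R i) ∧ (∀ j, ∑ i, α (i, j) = Cc j))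
    (hpq : (p * q).support ⊆ g.support) (hq : q ≠ 0) :
    ∃ ρ γ : Fin n → ℕ,
      ∀ α ∈ p.support, (∀ i, ∑ j, α (i, j) = ρ i) ∧ (∀ j, ∑ i, α (i, j) = γ j) := by
  obtain ⟨β, hβ⟩ := support_nonempty.mpr hq
  refine ⟨fun i => R i - ∑ j, β (i, j), fun j => Cc j - ∑ i, β (i, j), fun α hα => ?_⟩
  obtain ⟨hr, hc⟩ :=
    hg _ (hpq (Literature.Barriers.ValiantsHypothesis.add_mem_support_mul hα hβ))
  refine ⟨fun i => ?_, fun j => ?_⟩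
  · have h := hr i
    simp only [Finsupp.coe_add, Pi.add_apply, Finset.sum_add_distrib] at h
    show ∑ j, α (i, j) = R i - ∑ j, β (i, j)
    omega
  · have h := hc j
    simp only [Finsupp.coe_add, Pi.add_apply, Finset.sum_add_distrib] at h
    show ∑ i, α (i, j) = Cc j - ∑ i, β (i, j)
    omega

/-! ### Type rigidity of the pure monomials of type `R` -/

/-- The pure exponent vector of type `R` on `π`, `Σ_{j'} R(π j') · e_{(π j', j')}`, evaluated at the
cell `(i, j)`: `R i` on the matching cell `π j = i`, zero off the matching. [folklore] -/
theorem pureVec_apply (R : Fin n → ℕ) (π : Equiv.Perm (Fin n)) (i j : Fin n) :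
    (∑ j', Finsupp.single (π j', j') (R (π j'))) (i, j) = if π j = i then R i else 0 := by
  classical
  rw [Finsupp.finsetSum_apply, Finset.sum_eq_single j]
  · rw [Finsupp.single_apply]
    by_cases h : π j = i
    · subst h; simp
    · rw [if_neg (fun h' => h (Prod.mk.inj h').1), if_neg h]
  · intro j' _ hj'
    rw [Finsupp.single_apply, if_neg (fun h' => hj' (Prod.mk.inj h').2)]
  · simp

/-- **Type rigidity, arbitrary margins.** If all monomials of `p` have row sums `ρ` and column
sums `γ`, the permutations `π` whose pure monomial of type `R`, `Σ_j R(π j) e_{(π j, j)}`, is a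
monomial of `p * q` satisfy `ρ ∘ π = γ` (the `p`-part lies below the pure vector, which vanishes
off the cells `(π j, j)`, where both sums are read off), hence form at most one coset of the
stabiliser of the row support `{i | ρ i ≠ 0}`: at most `k! · (n - k)!` of them,
`k = #{i | ρ i ≠ 0}`. [folklore] -/
theorem card_pureServed_le_rows {p q : MvPolynomial (Fin n × Fin n) ℝ≥0} {ρ γ : Fin n → ℕ}
    (R : Fin n → ℕ)
    (hp : ∀ α ∈ p.support, (∀ i, ∑ j, α (i, j) = ρ i) ∧ (∀ j, ∑ i, α (i, j) = γ j)) :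
    (Finset.univ.filter fun π : Equiv.Perm (Fin n) =>
        (∑ j, Finsupp.single (π j, j) (R (π j))) ∈ (p * q).support).card ≤
      (Finset.univ.filter fun i => ρ i ≠ 0).card.factorial *
        (n - (Finset.univ.filter fun i => ρ i ≠ 0).card).factorial := by
  set Z : Finset (Fin n) := Finset.univ.filter fun i => ρ i ≠ 0 with hZ
  set T : Finset (Equiv.Perm (Fin n)) := Finset.univ.filter fun π => ∀ j, ρ (π j) = γ j with hT
  -- served permutations are typed
  have h1 : (Finset.univ.filter fun π : Equiv.Perm (Fin n) =>
      (∑ j, Finsupp.single (π j, j) (R (π j))) ∈ (p * q).support) ⊆ T := by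
    intro π hπ
    simp only [Finset.mem_filter, Finset.mem_univ, true_and, hT] at hπ ⊢
    obtain ⟨α, hα, β, -, hαβ⟩ := Finset.mem_add.mp (support_mul p q hπ)
    have hcell : ∀ i j, α (i, j) ≠ 0 → π j = i := by
      intro i j hij
      have h := DFunLike.congr_fun hαβ (i, j)
      rw [Finsupp.coe_add, Pi.add_apply, pureVec_apply] at h
      by_contra hne
      rw [if_neg hne] at h
      omega
    intro j
    obtain ⟨hr, hc⟩ := hp α hα
    have e1 : ∑ j', α (π j, j') = α (π j, j) := by
      refine Finset.sum_eq_single j (fun j' _ hj' => ?_) (by simp)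
      by_contra h
      exact hj' (π.injective (hcell _ _ h))
    have e2 : ∑ i, α (i, j) = α (π j, j) := by
      refine Finset.sum_eq_single (π j) (fun i _ hi => ?_) (by simp)
      by_contra h
      exact hi (hcell i j h).symm
    rw [← hr (π j), ← hc j, e1, e2]
  -- typed permutations form at most one coset of the stabiliser of `Z`
  have h3 := Literature.Computability.QuantumComplexity.PermanentPairing.card_perm_stabilising Z
  rw [Fintype.card_fin] at h3
  rw [← h3]
  refine (Finset.card_le_card h1).trans ?_
  rcases T.eq_empty_or_nonempty with hT0 | ⟨π₀, hπ₀⟩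
  · rw [hT0]; exact Nat.zero_le _
  have h0 : ∀ j, ρ (π₀ j) = γ j := (Finset.mem_filter.mp hπ₀).2
  refine Finset.card_le_card_of_injOn (fun π => π * π₀⁻¹) (fun π hπ => ?_)
    (fun π _ π' _ h => mul_right_cancel h)
  have hπ' : ∀ j, ρ (π j) = γ j := (Finset.mem_filter.mp (Finset.mem_coe.mp hπ)).2
  simp only [Finset.coe_filter, Finset.mem_univ, true_and, Set.mem_setOf_eq, hZ,
    Finset.mem_filter]
  intro i
  rw [show (π * π₀⁻¹) i = π (π₀.symm i) from rfl, hπ' (π₀.symm i), ← h0 (π₀.symm i),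
    Equiv.apply_symm_apply]

/-! ### The covering count with arbitrary margins -/

/-- Below a nonzero output all of whose monomials have row sums `R` with `R i ≥ 1` for all `i`
(so it meets all `n ≥ 3` rows) some gate value meets `k` rows with `n/3 < k ≤ 2(n/3)`.
[cite: JerrumSnir1982, §3.3] -/
theorem exists_rows_window_of_eval_ne_zero_rows (hn : 3 ≤ n) {R : Fin n → ℕ}
    (hR : ∀ i, 1 ≤ R i) (P : ArithCircuit ℝ≥0 (Fin n × Fin n)) (h2 : P.IsFanInTwo)
    (hP : ∀ α ∈ P.eval.support, ∀ i, ∑ j, α (i, j) = R i) (h0 : P.eval ≠ 0) :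
    ∃ v : ℕ, n / 3 < (((gateValues P.gates).getD v 0).vars.image Prod.fst).card ∧
      (((gateValues P.gates).getD v 0).vars.image Prod.fst).card ≤ 2 * (n / 3) := by
  have huniv : P.eval.vars.image Prod.fst = Finset.univ :=
    Finset.eq_univ_of_forall fun i =>
      (mem_image_fst_vars_iff hP h0 i).mpr (by have := hR i; omega)
  have hcard : 2 * (n / 3) < (P.eval.vars.image Prod.fst).card := by
    rw [huniv, Finset.card_univ, Fintype.card_fin]; omega
  have heval : P.eval = P.output.eval (gateValues P.gates) := rfl
  rcases hout : P.output with e | c | j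
  · rw [heval, hout, show (Operand.var e : Operand ℝ≥0 (Fin n × Fin n)).eval (gateValues P.gates)
      = X e from rfl, vars_X, Finset.image_singleton, Finset.card_singleton] at hcard
    omega
  · rw [heval, hout, show (Operand.const c : Operand ℝ≥0 (Fin n × Fin n)).eval
      (gateValues P.gates) = C c from rfl, vars_C, Finset.image_empty, Finset.card_empty] at hcard
    omega
  · rw [heval, hout, Operand.eval_gate] at hcard
    exact exists_gate_rows_window P.gates h2 (by omega) j hcard

/-- **Covering count, arbitrary margins (the typed vertex bound along the peeling).** Let `P` be
a fan-in-two circuit over `ℝ≥0` whose gate values vanish outside a set of at most `N` indices and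
whose output has row margins `R` (`R i ≥ 1`) and column margins `Cc`, `n ≥ 3`.  Then the
permutations `π` whose pure monomial of type `R` occurs in `P.eval` number at most
`N · n!/2^{⌊n/3⌋}`.  Induction on `N`: zero a gate `v` whose value `p` meets
`k ∈ (n/3, 2(n/3)]` rows (`exists_rows_window_of_eval_ne_zero_rows`);
`P.eval = (P.zeroAt v).eval + p · q` (`exists_eval_eq_zeroAt_add`), `p` is typed by
`supp (p · q) ⊆ supp P.eval`, its pure monomials serve at most `k!(n-k)!` permutations
(`card_pureServed_le_rows`) and `k!(n-k)! · 2^{⌊n/3⌋} ≤ k!(n-k)! · C(n,k) = n!`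
(`two_pow_le_choose_middle`); `P.zeroAt v` has one nonzero value fewer.
[cite: JerrumSnir1982, §3–§4.3] -/
theorem pure_cover_count_rows (hn : 3 ≤ n) {R Cc : Fin n → ℕ} (hR : ∀ i, 1 ≤ R i) :
    ∀ (N : ℕ) (P : ArithCircuit ℝ≥0 (Fin n × Fin n)), P.IsFanInTwo →
      (∃ Z : Finset ℕ, Z.card ≤ N ∧ ∀ j ∉ Z, (gateValues P.gates).getD j 0 = 0) →
      (∀ α ∈ P.eval.support, (∀ i, ∑ j, α (i, j) = R i) ∧ (∀ j, ∑ i, α (i, j) = Cc j)) →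
      (Finset.univ.filter fun π : Equiv.Perm (Fin n) =>
          (∑ j, Finsupp.single (π j, j) (R (π j))) ∈ P.eval.support).card * 2 ^ (n / 3) ≤
        N * n.factorial := by
  classical
  intro N
  induction N with
  | zero =>
    rintro P h2 ⟨Z, hZc, hZ0⟩ hg
    by_cases h0 : P.eval = 0
    · simp [h0]
    · exfalso
      obtain ⟨v, hlo, -⟩ :=
        exists_rows_window_of_eval_ne_zero_rows hn hR P h2 (fun α hα => (hg α hα).1) h0
      rw [hZ0 v (by simp [Finset.card_eq_zero.mp (Nat.le_zero.mp hZc)]), vars_0,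
        Finset.image_empty, Finset.card_empty] at hlo
      omega
  | succ N ih =>
    rintro P h2 ⟨Z, hZc, hZ0⟩ hg
    by_cases h0 : P.eval = 0
    · simp [h0]
    obtain ⟨v, hlo, hhi⟩ :=
      exists_rows_window_of_eval_ne_zero_rows hn hR P h2 (fun α hα => (hg α hα).1) h0
    obtain ⟨q, hq⟩ := exists_eval_eq_zeroAt_add P v
    have hlink := linked_gateValues_set P.gates v
    set p := (gateValues P.gates).getD v 0 with hpdef
    have hp0 : p ≠ 0 := by
      intro h
      rw [h, vars_0, Finset.image_empty, Finset.card_empty] at hlo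
      omega
    have hvZ : v ∈ Z := by_contra fun h => hp0 (hZ0 v h)
    -- the zeroed circuit: values vanish at `v` and wherever they vanished before
    have hZ' : ∃ Z' : Finset ℕ, Z'.card ≤ N ∧
        ∀ j ∉ Z', (gateValues (P.zeroAt v).gates).getD j 0 = 0 := by
      refine ⟨Z.erase v, ?_, fun j hj => ?_⟩
      · rw [Finset.card_erase_of_mem hvZ]; omega
      · obtain ⟨h, hh⟩ := hlink.2 j
        by_cases hjv : j = v
        · subst hjv
          rcases lt_or_ge j P.gates.length with hjl | hjl
          · rw [show (P.zeroAt j).gates = P.gates.set j zeroGate from rfl,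
              getD_gateValues (List.getElem?_set_self hjl)]
            simp [zeroGate, Gate.eval]
          · exact absurd (getD_gateValues_eq_zero (List.getElem?_eq_none_iff.mpr hjl)) hp0
        · have hjZ : j ∉ Z := fun h => hj (Finset.mem_erase.mpr ⟨hjv, h⟩)
          rw [hZ0 j hjZ] at hh
          have hs := support_subset_of_eq_add hh
          rwa [support_zero, Finset.subset_empty, support_eq_empty] at hs
    have hg' : ∀ α ∈ (P.zeroAt v).eval.support,
        (∀ i, ∑ j, α (i, j) = R i) ∧ (∀ j, ∑ i, α (i, j) = Cc j) :=
      fun α hα => hg α (support_subset_of_eq_add hq hα)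
    have hIH := ih (P.zeroAt v) (h2.zeroAt v) hZ' hg'
    -- the pure monomials of `P.eval` are those of the zeroed circuit or of the term `p * q`
    set G : Finset (Equiv.Perm (Fin n)) := Finset.univ.filter fun π =>
      (∑ j, Finsupp.single (π j, j) (R (π j))) ∈ (p * q).support with hG
    have hcover : (Finset.univ.filter fun π : Equiv.Perm (Fin n) =>
        (∑ j, Finsupp.single (π j, j) (R (π j))) ∈ P.eval.support) ⊆
        (Finset.univ.filter fun π : Equiv.Perm (Fin n) =>
          (∑ j, Finsupp.single (π j, j) (R (π j))) ∈ (P.zeroAt v).eval.support) ∪ G := by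
      intro π hπ
      simp only [Finset.mem_filter, Finset.mem_union, Finset.mem_univ, true_and, hG] at hπ ⊢
      rw [hq] at hπ
      exact Finset.mem_union.mp (support_add hπ)
    -- the term serves at most `n!/2^{n/3}` permutations
    have hGle : G.card * 2 ^ (n / 3) ≤ n.factorial := by
      by_cases hq0 : q = 0
      · simp [hG, hq0]
      have hsub : (p * q).support ⊆ P.eval.support :=
        support_subset_of_eq_add (hq.trans (add_comm _ _))
      obtain ⟨ρ, γ, hty⟩ := exists_sums_of_support_mul_subset_margins hg hsub hq0
      set k := (Finset.univ.filter fun i => ρ i ≠ 0).card with hk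
      have hkrows : (p.vars.image Prod.fst).card = k := by
        rw [hk]
        congr 1
        ext i
        simpa using mem_image_fst_vars_iff (fun α hα => (hty α hα).1) hp0 i
      rw [hkrows] at hlo hhi
      have hkn : k ≤ n := by omega
      calc G.card * 2 ^ (n / 3) ≤ k.factorial * (n - k).factorial * n.choose k :=
            Nat.mul_le_mul (card_pureServed_le_rows R hty) (two_pow_le_choose_middle hlo hhi)
        _ = n.factorial := by
            rw [mul_comm, ← mul_assoc]; exact Nat.choose_mul_factorial_mul_factorial hkn
    calc (Finset.univ.filter fun π : Equiv.Perm (Fin n) =>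
            (∑ j, Finsupp.single (π j, j) (R (π j))) ∈ P.eval.support).card * 2 ^ (n / 3)
        ≤ ((Finset.univ.filter fun π : Equiv.Perm (Fin n) =>
            (∑ j, Finsupp.single (π j, j) (R (π j))) ∈ (P.zeroAt v).eval.support).card +
            G.card) * 2 ^ (n / 3) :=
          Nat.mul_le_mul_right _
            ((Finset.card_le_card hcover).trans (Finset.card_union_le _ _))
      _ ≤ N * n.factorial + n.factorial := by rw [add_mul]; exact add_le_add hIH hGle
      _ = (N + 1) * n.factorial := by ring

/-! ### The stub -/

/-- **stub_pureCount — the typed vertex count for ARBITRARY margins.**  Let `g ∈ ℝ≥0[x_ij]`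
(`n ≥ 3`) have row margins `R` and column margins `Cc`, `R i ≥ 1` for every row.  Then the
permutations `π` whose PURE monomial of type `R`, `Σ_j R(π j) · e_{(π j, j)}`, occurs in `g` number
at most `L(g) · n!/2^{⌊n/3⌋}`: run `pure_cover_count_rows` on a fan-in-two circuit of size `L(g)`
computing `g` (`exists_computes_size_eq_complexity`), all of whose gate values beyond index `L(g)`
are the junk `0`. [cite: JerrumSnir1982, §3–§4.3] -/
theorem stub_pureCount :
    ∀ (n : ℕ) (g : MvPolynomial (Fin n × Fin n) ℝ≥0) (R Cc : Fin n → ℕ), 3 ≤ n →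
      (∀ i, 1 ≤ R i) →
      (∀ α ∈ g.support, (∀ i, ∑ j, α (i, j) = R i) ∧ (∀ j, ∑ i, α (i, j) = Cc j)) →
      (Finset.univ.filter fun π : Equiv.Perm (Fin n) =>
          (∑ j, Finsupp.single (π j, j) (R (π j))) ∈ g.support).card * 2 ^ (n / 3) ≤
        complexity g * n.factorial := by
  intro n g R Cc hn hR hg
  obtain ⟨P, h2, hP, hsize⟩ := exists_computes_size_eq_complexity g
  have heval : P.eval = g := hP
  have hZ : ∃ Z : Finset ℕ, Z.card ≤ P.size ∧ ∀ j ∉ Z, (gateValues P.gates).getD j 0 = 0 := by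
    refine ⟨Finset.range P.size, by simp, fun j hj => getD_gateValues_eq_zero ?_⟩
    exact List.getElem?_eq_none_iff.mpr (by simpa [ArithCircuit.size] using hj)
  have hcount := pure_cover_count_rows hn (Cc := Cc) hR P.size P h2 hZ (by rw [heval]; exact hg)
  rw [heval, hsize] at hcount
  exact hcount

end Summit.ValiantsHypothesis.ValiantsHypothesis.Theorems.DivisionGapPerDivisionHard

end
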